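import Mathlib
import HarnessLib
import Literature.MathematicalPhysics.QuantumFieldTheory.YangMillsOS

/-!
# `CurvatureKernelBound` — the crux-strategist's SPLIT by coupling regime (support for stmt-QuantumFields-11687)

Crux `stmt-QuantumFields-11687` (`PencilRigidity.CurvatureKernelBound`, also wanted by `MirrorModularBoosts` and
`CertificationLength`). Unit `cstrat-stmt-QuantumFields-11687-p1` (wall-breaker on the exhausted chain). The crux is
quantified over EVERY scaling scheme `sch` whose curvature correlators converge to a gapped OS limit; the tree's exact
characterisations (`CurvatureKernelBoundIffLocalDecay` p131429, `…IffSmearedEventually` p132686,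
`…IffSmearedFrequently` p132803) show that its content is the ultraviolet dimension bound `dim tr F² < 5` on that limit,
and the eight line leads found that nothing in `W₁` supplies it. This file separates the three physically distinct
regimes hiding under the universal quantifier, by the limit point of the inverse bare coupling along a subsequence:

* `CurvatureKernelBoundWeakCoupling`   — the crux for schemes with `sch.HasWeakCouplingLimit` (`β_k → +∞`): the summit's
  own side condition (statement re-type p116790); what every route's `closes` actually feeds the crux (the witness of
  `WeakCouplingHypercubicLimit` / `CertifiedHypercubicLimit` carries `hweak`); the UV half of the construction.
* `CurvatureKernelBoundFiniteCoupling` — the crux for schemes with `β_k → b ∈ ℝ`: continuum limits AT a finite bare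
  coupling (strong-coupling disc: degenerate; hypothetical finite-`β` critical point of 4D Wilson LGT: "no scalar of
  dimension ≥ 5 conjugate to `β`") — a lattice-gauge-theory phase-structure statement, NOT part of the Millennium-style
  construction.
* `CurvatureKernelBoundNegativeCoupling` — the crux for `β_k → -∞` (negative / frustrated Wilson coupling; no reflection
  positivity on odd tori) — a scope artefact of the universal quantifier.

`CurvatureKernelBound_of_subs : Weak → Finite → Negative → CurvatureKernelBound`, sorry-free: `W₁` passes to subsequence
schemes (the sub-scheme `k ↦ sch (φ k)` is built inside the proof, `exists_subseqScheme`; `latticeSchwinger` re-indexes by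
`rfl`; `HasLatticeMassGap` and the convergence clause are eventual/sequential), the kernel conclusion does not mention the
scheme, and `EReal` is sequentially compact (`exists_subseq_coupling_trichotomy`). The module imports NO route file (bodies
verbatim), so the gate can link it as the glue of `route edit --split CurvatureKernelBound` (`--glue-by`); it declares no
definition (the tree's named sub-scheme `Cruxes.HypercubicLimit.CouplingResponse.subseq` lives in a module that imports
`Theses.PencilRigidity`, which a glue module must avoid). Strategist's file `Cruxes/CurvatureKernelBound/Split.lean`
(planner-cstrat-stmt-QuantumFields-11687-p1-0), landed by line lead c8. [folklore]
-/

noncomputable section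

open scoped BigOperators Topology SchwartzMap
open MeasureTheory Filter Set
open Literature.MathematicalPhysics.QuantumLattice Literature.MathematicalPhysics.AQFT
  Literature.MathematicalPhysics.QuantumFieldTheory

namespace Summit.QuantumFields.YangMills.Theorems.CurvatureKernel

/-- **Coupling trichotomy along a subsequence.** Every real sequence has a subsequence tending to
`+∞`, or to `-∞`, or to a real number (sequential compactness of `EReal`). [folklore] -/
theorem exists_subseq_coupling_trichotomy : ∀ (u : ℕ → ℝ), ∃ φ : ℕ → ℕ, StrictMono φ ∧ (Filter.Tendsto (fun k => u (φ k)) Filter.atTop Filter.atTop ∨ Filter.Tendsto (fun k => u (φ k)) Filter.atTop Filter.atBot ∨ ∃ b : ℝ, Filter.Tendsto (fun k => u (φ k)) Filter.atTop (nhds b)) := by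
  intro u
  obtain ⟨x, φ, hφ, hx⟩ := CompactSpace.tendsto_subseq (fun k => ((u k : ℝ) : EReal))
  refine ⟨φ, hφ, ?_⟩
  induction x using EReal.rec with
  | bot =>
    refine Or.inr (Or.inl ?_)
    have h : Tendsto (fun k => ((u (φ k) : ℝ) : EReal)) atTop (𝓝 ⊥) := hx
    exact EReal.tendsto_coe_nhds_bot_iff.1 h
  | coe b =>
    refine Or.inr (Or.inr ⟨b, ?_⟩)
    have h : Tendsto (fun k => ((u (φ k) : ℝ) : EReal)) atTop (𝓝 (b : EReal)) := hx
    exact EReal.tendsto_coe.1 h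
  | top =>
    refine Or.inl ?_
    have h : Tendsto (fun k => ((u (φ k) : ℝ) : EReal)) atTop (𝓝 ⊤) := hx
    exact EReal.tendsto_coe_nhds_top_iff.1 h

/-- **Sub-schemes exist**: along a strictly increasing `φ` there is a scheme (all data composed with
`φ`) whose lattice `n`-point functions of the curvature are the re-indexed ones (definitionally),
whose couplings are `β ∘ φ`, and which keeps every uniform lattice mass gap. [folklore] -/
theorem exists_subseqScheme {G : Type} [Group G] [TopologicalSpace G] [IsTopologicalGroup G]
    [CompactSpace G] [MeasurableSpace G] [BorelSpace G] (r : LatticeRep G)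
    (sch : SpeciesScheme (YMSpecies G)) (φ : ℕ → ℕ) (hφ : StrictMono φ) :
    ∃ sch' : SpeciesScheme (YMSpecies G),
      (∀ (k n : ℕ) (f : Fin n → 𝓢(EuclideanSpace ℝ (Fin 4), ℝ)),
          latticeSchwinger r.ρ sch' (fun s => s.F) k n (fun _ => r.curvature) f =
            latticeSchwinger r.ρ sch (fun s => s.F) (φ k) n (fun _ => r.curvature) f) ∧
        (sch'.β = fun k => sch.β (φ k)) ∧
        ∀ Δ : ℝ, HasLatticeMassGap r sch Δ → HasLatticeMassGap r sch' Δ := by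
  refine ⟨{ a := fun k => sch.a (φ k)
            a_pos := fun k => sch.a_pos (φ k)
            tendsto_a := sch.tendsto_a.comp hφ.tendsto_atTop
            β := fun k => sch.β (φ k)
            L := fun k => sch.L (φ k)
            tendsto_L := sch.tendsto_L.comp hφ.tendsto_atTop
            c := fun s k => sch.c s (φ k)
            m := fun s k => sch.m s (φ k) }, fun _ _ _ => rfl, rfl, ?_⟩
  intro Δ h A B
  obtain ⟨C, hC⟩ := h A B
  exact ⟨C, hφ.tendsto_atTop.eventually hC⟩

/-- **Strategist's split of `PencilRigidity.CurvatureKernelBound`** (stmt-QuantumFields-11687):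
`CurvatureKernelBoundWeakCoupling → CurvatureKernelBoundFiniteCoupling →
CurvatureKernelBoundNegativeCoupling → CurvatureKernelBound`, every body VERBATIM (this module is
route-file-free, so the gate can link it with `--glue-by`). The three children are the crux with ONE extra
hypothesis on the scheme's inverse bare coupling: `β_k → +∞` (`sch.HasWeakCouplingLimit`, the summit's own
side condition: the ultraviolet half of the construction at the asymptotically free fixed point),
`β_k → b ∈ ℝ` (a continuum limit AT a finite bare coupling: the strong-coupling disc and the hypothetical
finite-`β` critical points of 4D Wilson lattice gauge theory), `β_k → -∞` (negative / frustrated coupling).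
Proof: the curvature package `W₁` passes to every subsequence scheme (`latticeSchwinger` re-indexes
definitionally, `HasLatticeMassGap` and the convergence clause are eventual / sequential), the conclusion does
not mention the scheme, and every real sequence `β_k` has a subsequence in one of the three regimes
(`exists_subseq_coupling_trichotomy`). [folklore] -/
theorem CurvatureKernelBound_of_subs :
    (let E := EuclideanSpace ℝ (Fin 4); ∀ (G : Type) [Group G] [TopologicalSpace G] [IsTopologicalGroup G] [CompactSpace G], IsCompactSimpleLieGroup G → letI : MeasurableSpace G := borel G; haveI : BorelSpace G := ⟨rfl⟩; let W₁ := fun (r : LatticeRep G) (sch : SpeciesScheme (YMSpecies G)) (S₁ : SchwingerFamily E) => ((∀ (n : ℕ), n ≠ 0 → ∀ (f : Fin n → SchwartzMap (E) ℝ) (F : SchwartzMap (Fin n → E) ℂ), IsTensorOf F (fun i => ofRealTest (f i)) → IsOffDiagonal F → Filter.Tendsto (fun k : ℕ => ((latticeSchwinger r.ρ sch (fun s => s.F) k n (fun _ => r.curvature) f : ℝ) : ℂ)) Filter.atTop (nhds (S₁ n F))) ∧ (S₁.toLabelled.IsNormalized ∧ S₁.toLabelled.IsHermitian ∧ S₁.toLabelled.HasLinearGrowth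 ∧ S₁.toLabelled.IsReflectionPositive ∧ S₁.toLabelled.IsSymmetric ∧ S₁.toLabelled.HasClusterProperty) ∧ (∀ (n : ℕ) (a : E) (F : SchwartzMap (Fin n → E) ℂ), IsOffDiagonal F → S₁ n (translateMulti a F) = S₁ n F) ∧ (∀ (R : E ≃ₗᵢ[ℝ] E), LinearMap.det (R.toLinearEquiv : E →ₗ[ℝ] E) = 1 → (∀ i : Fin 4, ∃ j : Fin 4, R (EuclideanSpace.single i 1) = EuclideanSpace.single j 1 ∨ R (EuclideanSpace.single i 1) = -EuclideanSpace.single j 1) → ∀ (n : ℕ) (F : SchwartzMap (Fin n → E) ℂ), IsOffDiagonal F → S₁ n (linActMulti R F) = S₁ n F) ∧ (∃ Δ : ℝ, 0 < Δ ∧ S₁.toLabelled.HasMassGap Δ ∧ HasLatticeMassGap r sch Δ)); ∀ (r : LatticeRep G) (sch : SpeciesScheme (YMSpecies G)) (S₁ : SchwingerFamily E), W₁ r sch S₁ → sch.HasWeakCouplingLimit → ∃ (K : E → ℝ) (C η : ℝ), 0 < η ∧ ContinuousOn K {x : E | x ≠ 0} ∧ (∀ x : E, x ≠ 0 → |K x|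 ≤ C * (1 + ‖x‖ ^ (η - 10))) ∧ ∀ F : SchwartzMap (Fin 2 → E) ℂ, IsOffDiagonal F → MeasureTheory.Integrable (fun x : Fin 2 → E => (K (x 0 - x 1) : ℂ) * F x) ∧ S₁ 2 F = ∫ x : Fin 2 → E, (K (x 0 - x 1) : ℂ) * F x) →
    (let E := EuclideanSpace ℝ (Fin 4); ∀ (G : Type) [Group G] [TopologicalSpace G] [IsTopologicalGroup G] [CompactSpace G], IsCompactSimpleLieGroup G → letI : MeasurableSpace G := borel G; haveI : BorelSpace G := ⟨rfl⟩; let W₁ := fun (r : LatticeRep G) (sch : SpeciesScheme (YMSpecies G)) (S₁ : SchwingerFamily E) => ((∀ (n : ℕ), n ≠ 0 → ∀ (f : Fin n → SchwartzMap (E) ℝ) (F : SchwartzMap (Fin n → E) ℂ), IsTensorOf F (fun i => ofRealTest (f i)) → IsOffDiagonal F → Filter.Tendsto (fun k : ℕ => ((latticeSchwinger r.ρ sch (fun s => s.F) k n (fun _ => r.curvature) f : ℝ) : ℂ)) Filter.atTop (nhds (S₁ n F))) ∧ (S₁.toLabelled.IsNormalized ∧ S₁.toLabelled.IsHermitian ∧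 S₁.toLabelled.HasLinearGrowth ∧ S₁.toLabelled.IsReflectionPositive ∧ S₁.toLabelled.IsSymmetric ∧ S₁.toLabelled.HasClusterProperty) ∧ (∀ (n : ℕ) (a : E) (F : SchwartzMap (Fin n → E) ℂ), IsOffDiagonal F → S₁ n (translateMulti a F) = S₁ n F) ∧ (∀ (R : E ≃ₗᵢ[ℝ] E), LinearMap.det (R.toLinearEquiv : E →ₗ[ℝ] E) = 1 → (∀ i : Fin 4, ∃ j : Fin 4, R (EuclideanSpace.single i 1) = EuclideanSpace.single j 1 ∨ R (EuclideanSpace.single i 1) = -EuclideanSpace.single j 1) → ∀ (n : ℕ) (F : SchwartzMap (Fin n → E) ℂ), IsOffDiagonal F → S₁ n (linActMulti R F) = S₁ n F) ∧ (∃ Δ : ℝ, 0 < Δ ∧ S₁.toLabelled.HasMassGap Δ ∧ HasLatticeMassGap r sch Δ)); ∀ (r : LatticeRep G) (sch : SpeciesScheme (YMSpecies G)) (S₁ : SchwingerFamily E), W₁ r sch S₁ → (∃ b : ℝ, Filter.Tendsto sch.β Filter.atTop (nhds b)) → ∃ (K : E → ℝ) (C η : ℝ), 0 < η ∧ ContinuousOn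 K {x : E | x ≠ 0} ∧ (∀ x : E, x ≠ 0 → |K x| ≤ C * (1 + ‖x‖ ^ (η - 10))) ∧ ∀ F : SchwartzMap (Fin 2 → E) ℂ, IsOffDiagonal F → MeasureTheory.Integrable (fun x : Fin 2 → E => (K (x 0 - x 1) : ℂ) * F x) ∧ S₁ 2 F = ∫ x : Fin 2 → E, (K (x 0 - x 1) : ℂ) * F x) →
    (let E := EuclideanSpace ℝ (Fin 4); ∀ (G : Type) [Group G] [TopologicalSpace G] [IsTopologicalGroup G] [CompactSpace G], IsCompactSimpleLieGroup G → letI : MeasurableSpace G := borel G; haveI : BorelSpace G := ⟨rfl⟩; let W₁ := fun (r : LatticeRep G) (sch : SpeciesScheme (YMSpecies G)) (S₁ : SchwingerFamily E) => ((∀ (n : ℕ), n ≠ 0 → ∀ (f : Fin n → SchwartzMap (E) ℝ) (F : SchwartzMap (Fin n → E) ℂ), IsTensorOf F (fun i => ofRealTest (f i)) → IsOffDiagonal F → Filter.Tendsto (fun k : ℕ => ((latticeSchwinger r.ρ sch (fun s => s.F) k n (fun _ => r.curvature) f : ℝ) : ℂ)) Filter.atTop (nhds (S₁ n F))) ∧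 (S₁.toLabelled.IsNormalized ∧ S₁.toLabelled.IsHermitian ∧ S₁.toLabelled.HasLinearGrowth ∧ S₁.toLabelled.IsReflectionPositive ∧ S₁.toLabelled.IsSymmetric ∧ S₁.toLabelled.HasClusterProperty) ∧ (∀ (n : ℕ) (a : E) (F : SchwartzMap (Fin n → E) ℂ), IsOffDiagonal F → S₁ n (translateMulti a F) = S₁ n F) ∧ (∀ (R : E ≃ₗᵢ[ℝ] E), LinearMap.det (R.toLinearEquiv : E →ₗ[ℝ] E) = 1 → (∀ i : Fin 4, ∃ j : Fin 4, R (EuclideanSpace.single i 1) = EuclideanSpace.single j 1 ∨ R (EuclideanSpace.single i 1) = -EuclideanSpace.single j 1) → ∀ (n : ℕ) (F : SchwartzMap (Fin n → E) ℂ), IsOffDiagonal F → S₁ n (linActMulti R F) = S₁ n F) ∧ (∃ Δ : ℝ, 0 < Δ ∧ S₁.toLabelled.HasMassGap Δ ∧ HasLatticeMassGap r sch Δ)); ∀ (r : LatticeRep G) (sch : SpeciesScheme (YMSpecies G)) (S₁ : SchwingerFamily E), W₁ r sch S₁ → Filter.Tendsto sch.β Filter.atTop Filter.atBot → ∃ (K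 : E → ℝ) (C η : ℝ), 0 < η ∧ ContinuousOn K {x : E | x ≠ 0} ∧ (∀ x : E, x ≠ 0 → |K x| ≤ C * (1 + ‖x‖ ^ (η - 10))) ∧ ∀ F : SchwartzMap (Fin 2 → E) ℂ, IsOffDiagonal F → MeasureTheory.Integrable (fun x : Fin 2 → E => (K (x 0 - x 1) : ℂ) * F x) ∧ S₁ 2 F = ∫ x : Fin 2 → E, (K (x 0 - x 1) : ℂ) * F x) →
    (let E := EuclideanSpace ℝ (Fin 4); ∀ (G : Type) [Group G] [TopologicalSpace G] [IsTopologicalGroup G] [CompactSpace G], IsCompactSimpleLieGroup G → letI : MeasurableSpace G := borel G; haveI : BorelSpace G := ⟨rfl⟩; let W₁ := fun (r : LatticeRep G) (sch : SpeciesScheme (YMSpecies G)) (S₁ : SchwingerFamily E) => ((∀ (n : ℕ), n ≠ 0 → ∀ (f : Fin n → SchwartzMap (E) ℝ) (F : SchwartzMap (Fin n → E) ℂ), IsTensorOf F (fun i => ofRealTest (f i)) → IsOffDiagonal F → Filter.Tendsto (fun k : ℕ => ((latticeSchwinger r.ρ sch (fun s => s.F) k n (fun _ => r.curvature) f : ℝ)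 : ℂ)) Filter.atTop (nhds (S₁ n F))) ∧ (S₁.toLabelled.IsNormalized ∧ S₁.toLabelled.IsHermitian ∧ S₁.toLabelled.HasLinearGrowth ∧ S₁.toLabelled.IsReflectionPositive ∧ S₁.toLabelled.IsSymmetric ∧ S₁.toLabelled.HasClusterProperty) ∧ (∀ (n : ℕ) (a : E) (F : SchwartzMap (Fin n → E) ℂ), IsOffDiagonal F → S₁ n (translateMulti a F) = S₁ n F) ∧ (∀ (R : E ≃ₗᵢ[ℝ] E), LinearMap.det (R.toLinearEquiv : E →ₗ[ℝ] E) = 1 → (∀ i : Fin 4, ∃ j : Fin 4, R (EuclideanSpace.single i 1) = EuclideanSpace.single j 1 ∨ R (EuclideanSpace.single i 1) = -EuclideanSpace.single j 1) → ∀ (n : ℕ) (F : SchwartzMap (Fin n → E) ℂ), IsOffDiagonal F → S₁ n (linActMulti R F) = S₁ n F) ∧ (∃ Δ : ℝ, 0 < Δ ∧ S₁.toLabelled.HasMassGap Δ ∧ HasLatticeMassGap r sch Δ)); ∀ (r : LatticeRep G) (sch : SpeciesScheme (YMSpecies G)) (S₁ : SchwingerFamily E), W₁ r sch S₁ → ∃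 (K : E → ℝ) (C η : ℝ), 0 < η ∧ ContinuousOn K {x : E | x ≠ 0} ∧ (∀ x : E, x ≠ 0 → |K x| ≤ C * (1 + ‖x‖ ^ (η - 10))) ∧ ∀ F : SchwartzMap (Fin 2 → E) ℂ, IsOffDiagonal F → MeasureTheory.Integrable (fun x : Fin 2 → E => (K (x 0 - x 1) : ℂ) * F x) ∧ S₁ 2 F = ∫ x : Fin 2 → E, (K (x 0 - x 1) : ℂ) * F x) := by
  intro hW hF hN E G _ _ _ _ hG W₁ r sch S₁ hW₁
  letI : MeasurableSpace G := borel G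
  haveI : BorelSpace G := ⟨rfl⟩
  obtain ⟨hconv, hpkg, htr, hhyp, Δ, hΔ, hgap, hlat⟩ := hW₁
  obtain ⟨φ, hφ, hcase⟩ := exists_subseq_coupling_trichotomy sch.β
  obtain ⟨sch', hls, hβ, hgap'⟩ := exists_subseqScheme r sch φ hφ
  -- the curvature package of the subsequence scheme
  have hW₁' : W₁ r sch' S₁ := by
    refine ⟨?_, hpkg, htr, hhyp, Δ, hΔ, hgap, hgap' Δ hlat⟩
    intro n hn f F hF hoff
    have h := (hconv n hn f F hF hoff).comp hφ.tendsto_atTop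
    refine h.congr (fun k => ?_)
    simp only [Function.comp_apply, hls]
  have hcase' : Tendsto sch'.β atTop atTop ∨ Tendsto sch'.β atTop atBot ∨
      ∃ b : ℝ, Tendsto sch'.β atTop (𝓝 b) := by
    rw [hβ]; exact hcase
  rcases hcase' with htop | hbot | ⟨b, hb⟩
  · exact hW G hG r sch' S₁ hW₁' htop
  · exact hN G hG r sch' S₁ hW₁' hbot
  · exact hF G hG r sch' S₁ hW₁' ⟨b, hb⟩

end Summit.QuantumFields.YangMills.Theorems.CurvatureKernel

end
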